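import Summits.HodgeConjecture.HodgeConjecture.Theses.SaitoKurokawaBridge
import Summits.HodgeConjecture.HodgeConjecture.Theorems.SaitoKurokawaBridgeSaitoKurokawaBridgeGlue
import Literature.AlgebraicGeometry.HodgeTheory.SupportedClassesIrreducible
import Literature.AlgebraicGeometry.HodgeTheory.SupportedClassesIrreducibleSupports
import Literature.AlgebraicGeometry.HodgeTheory.ComplexOrientationFamily
import Literature.AlgebraicGeometry.HodgeTheory.GysinFormalismCorrespondences
import Literature.AlgebraicGeometry.HodgeTheory.CorrespondenceCupProductIdentities
import Literature.AlgebraicGeometry.Motives.CyclesDimensionProofs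
import Literature.AlgebraicTopology.SingularHomology.CupProductProofs

/-!
# Route `SaitoKurokawaBridge`: the split of the deciding crux `ExtremeBridgeFailure` (glue item stmt-HodgeConjecture-18239)

Landed from the crux-strategist's kernel-checked file `Cruxes/ExtremeBridgeFailure/ExtremeBridgeFailureSplit.lean`
(not importable from `Theorems/`), verbatim up to this paragraph.

Same mathematics as `ExtremeBridgeFailureSplit.lean` of this crux directory, but stated directly against
the route decls `SaitoKurokawaCoverPeriodsVanish` (item 18127) and `ExtremeBridgeFailureSplitGlue`
(glue item 18239) of route file rev ≥ 12 — this is the file a PROVER lands verbatim as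
`Summits/HodgeConjecture/HodgeConjecture/Theorems/SaitoKurokawaBridgeExtremeBridgeFailureSplit.lean`
(`--workitem stmt-HodgeConjecture-18239`; `noAlgebraicSaitoKurokawaBridge_of_pieces` supports 14459):

* `noAlgebraicSaitoKurokawaBridge_of_pieces :
    SupportedBridgeClassesVanish → SaitoKurokawaCoverPeriodsVanish → NoAlgebraicSaitoKurokawaBridge`
* `extremeBridgeFailure_of_pieces :
    SaitoKurokawaHodgeClass → SupportedBridgeClassesVanish → SaitoKurokawaCoverPeriodsVanish → ExtremeBridgeFailure`
* `extremeBridgeFailureSplitGlue_proof : ExtremeBridgeFailureSplitGlue` (the glue item BY NAME).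
-/

set_option linter.dupNamespace false

open CategoryTheory MonoidalCategory AlgebraicGeometry
open Literature.AlgebraicGeometry Literature.AlgebraicGeometry.HodgeTheory
open Literature.AlgebraicTopology.SingularHomology


namespace Summit.HodgeConjecture.HodgeConjecture.Theorems

open Summit.HodgeConjecture.HodgeConjecture.Theses.SaitoKurokawaBridge
open CartesianMonoidalCategory SemiCartesianMonoidalCategory

/-- **No-go lemma (A) for the FIRST factor**, derived from the second-factor version
`SupportedBridgeClassesVanish` by the symmetry `β : Y ⊗ X ≅ X ⊗ Y` of the fibre product: a class on
`Y ⊗ X` dying off `pr_Y⁻¹(Y')`, `Y' ⊊ Y` Zariski-closed, pairs to zero with `fst*a ∪ snd*b` whenever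
`a` is of Hodge type `(n,0)` or `(0,n)`. Transport `κ ↦ (β⁻¹)^*κ` (the support `pr_Y⁻¹ Y'` becomes
the second-factor support on `X ⊗ Y`: `complexBetti.restrictCompl_map_eq_zero`, `braiding_inv_fst`),
apply the hypothesis on `X ⊗ Y`, pull back along `β` (`cupProduct_map`, `braiding_hom_fst/snd`,
`β.hom ≫ β.inv = 𝟙`) and reorder the two degree-`n` factors by associativity and graded
commutativity (`cupProduct_gradedComm_holds`, sign `(-1)^{n·n}`). -/
theorem supportedBridgeClassesVanish_fst (hA : SupportedBridgeClassesVanish) (n : ℕ)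
    (Y X : Motives.SchemeOver ℂ) (hY : Motives.IsSmoothProjective n Y)
    (hX : Motives.IsSmoothProjective n X) (Y' : Set Y.left) (hY'c : IsClosed Y')
    (hY'u : Y' ≠ Set.univ) (κ : complexBetti (Y ⊗ X) (2 * n))
    (hκ : complexBetti.restrictCompl (Y ⊗ X) ((fst Y X).left.base ⁻¹' Y') (2 * n) κ = 0)
    (a : complexBetti Y n) (b : complexBetti X n)
    (ha : IsOfHodgeType n Y n n 0 a ∨ IsOfHodgeType n Y n 0 n a) :
    cupProduct (rfl : (2 * n + n) + n = 2 * n + n + n)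
        (cupProduct (rfl : 2 * n + n = 2 * n + n) κ (complexBetti.map (fst Y X) n a))
        (complexBetti.map (snd Y X) n b) = 0 := by
  -- transport the class to `X ⊗ Y`
  set κ'' : complexBetti (X ⊗ Y) (2 * n) := complexBetti.map (β_ Y X).inv (2 * n) κ with hκ''
  have hsupp : complexBetti.restrictCompl (X ⊗ Y) ((snd X Y).left.base ⁻¹' Y') (2 * n) κ'' = 0 := by
    have h := complexBetti.restrictCompl_map_eq_zero (β_ Y X).inv hκ
    have hset : ((β_ Y X).inv.left.base ⁻¹' ((fst Y X).left.base ⁻¹' Y')) =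
        (snd X Y).left.base ⁻¹' Y' := by
      have hb : (β_ Y X).inv ≫ fst Y X = snd X Y := braiding_inv_fst Y X
      rw [← hb]
      simp only [Over.comp_left, Scheme.Hom.comp_base, TopCat.coe_comp, Set.preimage_comp]
    rw [hset] at h
    exact h
  -- the second-factor lemma on `X ⊗ Y`
  have h0 := hA n X Y hX hY Y' hY'c hY'u κ'' hsupp b a ha
  -- pull back along `β.hom : Y ⊗ X ⟶ X ⊗ Y`
  have h1 := congrArg (complexBetti.map (β_ Y X).hom (2 * n + n + n)) h0
  rw [map_zero, complexBetti.map_cupProduct, complexBetti.map_cupProduct, hκ'',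
    ← complexBetti.map_comp_apply', ← complexBetti.map_comp_apply',
    ← complexBetti.map_comp_apply', Iso.hom_inv_id, complexBetti.map_id, braiding_hom_fst,
    braiding_hom_snd] at h1
  rw [ModuleCat.id_apply] at h1
  -- `h1 : (κ ∪ snd*b) ∪ fst*a = 0`; reorder the last two factors
  rw [cupProduct_assoc (rfl : 2 * n + n = 2 * n + n) (rfl : n + n = n + n) rfl
    (show 2 * n + (n + n) = 2 * n + n + n by omega)] at h1 ⊢
  rw [cupProduct_gradedComm_holds ℂ _ (rfl : n + n = n + n) (rfl : n + n = n + n)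
    (complexBetti.map (fst Y X) n a) (complexBetti.map (snd Y X) n b), map_smul, h1, smul_zero]

/-- The image of a composite `g ≫ f` on points is the image under `f` of the image of `g`; hence a
morphism `g` onto `V` followed by a projection with `pr(V)` dense is dominant. -/
theorem closure_range_comp_eq_univ {W P Y : Motives.SchemeOver ℂ} (g : W ⟶ P) (f : P ⟶ Y)
    {V : Set P.left} (hg : Set.range g.left.base = V)
    (hV : closure (f.left.base '' V) = Set.univ) :
    closure (Set.range (g ≫ f).left.base) = Set.univ := by
  have : Set.range (g ≫ f).left.base = f.left.base '' V := by
    rw [← hg, ← Set.range_comp, Over.comp_left, Scheme.Hom.comp_base, TopCat.coe_comp]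
  rw [this, hV]

/-- **The universal half reduces to periods on common covers**:
`SupportedBridgeClassesVanish → SaitoKurokawaCoverPeriodsVanish → NoAlgebraicSaitoKurokawaBridge`.
Write `P = M.Z ⊗ N.Z` (smooth projective of dimension `34`). (1) `N¹⁷H³⁴(P)` is the sum over the
IRREDUCIBLE closed `V ⊆ P` of codimension exactly `17` of `K_V = ker (H³⁴(P) → H³⁴(P ∖ V))`
(`algebraicClasses_eq_iSup_coheight_genericPoint_eq`), and the pairing `κ ↦ κ ∪ fst*a ∪ snd*b` is
linear, so one `V` at a time suffices. (2) If `pr_N(V)` is not dense, `V ⊆ pr_N⁻¹(X')` with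
`X' = closure pr_N(V) ⊊ N.Z` closed and no-go lemma (A) (`b` of type `(0,17)`) kills the pairing; if
`pr_M(V)` is not dense, its first-factor version `supportedBridgeClassesVanish_fst` (`a` of type
`(17,0)`) does. (3) If `V` dominates both factors: by Deligne (Hodge III 8.2.8) with Hironaka
(`exists_resolution_ker_restrictCompl_eq`, for the complex orientation family) there is a smooth
projective `W` of dimension `d = dim V` and `g : W ⟶ P` onto `V` with `K_V = Σ_a im g_*`;
`d = 17` since `height + coheight = 34` on the irreducible smooth `34`-fold `P`
(`height_add_coheight_eq_of_smoothOfRelativeDimension`), so `κ = g_* γ` with `γ ∈ H⁰(W)`; then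
`κ ∪ (fst*a ∪ snd*b) = (fst*a ∪ snd*b) ∪ g_*γ` (graded commutativity in even degrees)
`= g_*(g^*(fst*a ∪ snd*b) ∪ γ)` (projection formula `complexGysin_cup`) and
`g^*(fst*a ∪ snd*b) = p^*a ∪ q^*b = 0` for the dominant `p = g ≫ fst`, `q = g ≫ snd` by the period
piece. -/
theorem noAlgebraicSaitoKurokawaBridge_of_pieces (hA : SupportedBridgeClassesVanish)
    (hP : SaitoKurokawaCoverPeriodsVanish) : NoAlgebraicSaitoKurokawaBridge := by
  intro M N a b haG ha hbG hb κ' hκ'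
  have hM : Motives.IsSmoothProjective 17 M.Z := M.isSmoothProjective
  have hN : Motives.IsSmoothProjective 17 N.Z := N.isSmoothProjective
  have hMN : Motives.IsSmoothProjective (17 + 17) (M.Z ⊗ N.Z) :=
    Motives.IsSmoothProjective.tensor_holds hM hN
  -- the pairing as a linear functional
  let L : complexBetti (M.Z ⊗ N.Z) (2 * 17) →ₗ[ℂ] complexBetti (M.Z ⊗ N.Z) (2 * 17 + 17 + 17) :=
    ((cupProduct (rfl : 2 * 17 + 17 + 17 = 2 * 17 + 17 + 17)).flip
        (complexBetti.map (snd M.Z N.Z) 17 b)) ∘ₗ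
      ((cupProduct (rfl : 2 * 17 + 17 = 2 * 17 + 17)).flip (complexBetti.map (fst M.Z N.Z) 17 a))
  have hL : ∀ κ, L κ = cupProduct (rfl : 2 * 17 + 17 + 17 = 2 * 17 + 17 + 17)
      (cupProduct (rfl : 2 * 17 + 17 = 2 * 17 + 17) κ (complexBetti.map (fst M.Z N.Z) 17 a))
      (complexBetti.map (snd M.Z N.Z) 17 b) := fun κ ↦ rfl
  suffices hle : algebraicClasses (M.Z ⊗ N.Z) 17 ≤ LinearMap.ker L by
    have := hle hκ'
    rwa [LinearMap.mem_ker, hL] at this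
  rw [algebraicClasses_eq_iSup_coheight_genericPoint_eq hMN 17]
  refine iSup_le fun V ↦ iSup_le fun hVc ↦ iSup_le fun hVi ↦ iSup_le fun hVl ↦ iSup_le fun hη ↦ ?_
  by_cases hsnd : closure ((snd M.Z N.Z).left.base '' V) = Set.univ
  · by_cases hfst : closure ((fst M.Z N.Z).left.base '' V) = Set.univ
    · -- (3) `V` dominates both factors: resolve and use the period piece
      obtain ⟨d, W, hW, g, hheight, hrange, hker⟩ := exists_resolution_ker_restrictCompl_eq hMN
        complexOrientationFamily hasPoincareDuality_complexOrientationFamily hVc hVi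
      -- `d = 17`
      have hd : d = 17 := by
        haveI := hMN.smoothOfRelativeDimension
        haveI : IrreducibleSpace (M.Z ⊗ N.Z).left :=
          haveI := hMN.geometricallyIrreducible
          GeometricallyIrreducible.irreducibleSpace_of_subsingleton (M.Z ⊗ N.Z).hom
        have hsum := Motives.height_add_coheight_eq_of_smoothOfRelativeDimension (M.Z ⊗ N.Z).hom
          (17 + 17) hVi.genericPoint
        rw [hheight, hη] at hsum
        have : ((d + 17 : ℕ) : ℕ∞) = ((17 + 17 : ℕ) : ℕ∞) := by push_cast at hsum ⊢; exact hsum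
        have := ENat.coe_inj.1 this
        omega
      subst hd
      rw [hker (2 * 17)]
      refine iSup_le fun e ↦ iSup_le fun he ↦ ?_
      rintro κ ⟨γ, rfl⟩
      obtain rfl : e = 0 := by omega
      rw [LinearMap.mem_ker, hL]
      -- `p^*a ∪ q^*b = 0` on `W`
      have hper := hP M N a b haG ha hbG hb W hW (g ≫ fst M.Z N.Z) (g ≫ snd M.Z N.Z)
        (closure_range_comp_eq_univ g _ hrange hfst) (closure_range_comp_eq_univ g _ hrange hsnd)
      rw [complexBetti.map_comp_apply', complexBetti.map_comp_apply',
        ← complexBetti.map_cupProduct] at hper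
      -- reassociate and flip: `g_*γ ∪ x = x ∪ g_*γ = g_*(g^*x ∪ γ) = 0`
      rw [cupProduct_assoc (rfl : 2 * 17 + 17 = 2 * 17 + 17) (rfl : 17 + 17 = 17 + 17) rfl
        (show 2 * 17 + (17 + 17) = 2 * 17 + 17 + 17 by omega),
        cupProduct_gradedComm_holds ℂ _ (show 2 * 17 + (17 + 17) = 2 * 17 + 17 + 17 by omega)
          (show (17 + 17) + 2 * 17 = 2 * 17 + 17 + 17 by omega),
        ← complexGysin_cup hasPoincareDuality_complexOrientationFamily hW hMN g
          (hpq := (rfl : (17 + 17) + 0 = 17 + 17))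
          (hab := (show (17 + 17) + 2 * (17 + 17) = (2 * 17 + 17 + 17) + 2 * 17 by omega))
          (hq := he) (hpq' := (show (17 + 17) + 2 * 17 = 2 * 17 + 17 + 17 by omega)),
        hper, LinearMap.map_zero₂, map_zero, smul_zero]
    · -- (2) `V` does not dominate `M.Z`: first-factor no-go lemma with `a` of type `(17,0)`
      intro κ hκ
      rw [LinearMap.mem_ker, hL]
      have hsub : V ⊆ (fst M.Z N.Z).left.base ⁻¹' closure ((fst M.Z N.Z).left.base '' V) :=
        fun v hv ↦ subset_closure (Set.mem_image_of_mem _ hv)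
      have hκ1 := ker_restrictCompl_le_of_subset hsub (2 * 17) hκ
      exact supportedBridgeClassesVanish_fst hA 17 M.Z N.Z hM hN _ isClosed_closure hfst κ hκ1 a b
        (Or.inl ha)
  · -- (2) `V` does not dominate `N.Z`: no-go lemma (A) with `b` of type `(0,17)`
    intro κ hκ
    rw [LinearMap.mem_ker, hL]
    have hsub : V ⊆ (snd M.Z N.Z).left.base ⁻¹' closure ((snd M.Z N.Z).left.base '' V) :=
      fun v hv ↦ subset_closure (Set.mem_image_of_mem _ hv)
    have hκ1 := ker_restrictCompl_le_of_subset hsub (2 * 17) hκ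
    exact hA 17 M.Z N.Z hM hN _ isClosed_closure hsnd κ hκ1 a b (Or.inr hb)

/-- **ASSEMBLY of the decomposition of `ExtremeBridgeFailure`** (pieces → restated deciding crux):
`SaitoKurokawaHodgeClass → SupportedBridgeClassesVanish → SaitoKurokawaCoverPeriodsVanish → ExtremeBridgeFailure`,
by `noAlgebraicSaitoKurokawaBridge_of_pieces` and the landed glue `saitoKurokawaBridgeGlue_proof`
(instantiate `n = 17`, `Y = M.Z`, `X = N.Z`). -/
theorem extremeBridgeFailure_of_pieces :
    SaitoKurokawaHodgeClass → SupportedBridgeClassesVanish → SaitoKurokawaCoverPeriodsVanish →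
      ExtremeBridgeFailure :=
  fun hW hA hP ↦ saitoKurokawaBridgeGlue_proof hW (noAlgebraicSaitoKurokawaBridge_of_pieces hA hP)

/-- **The glue item `ExtremeBridgeFailureSplitGlue` (stmt-HodgeConjecture-18239) BY NAME.** -/
theorem extremeBridgeFailureSplitGlue_proof : ExtremeBridgeFailureSplitGlue :=
  extremeBridgeFailure_of_pieces

end Summit.HodgeConjecture.HodgeConjecture.Theorems
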